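import Mathlib
import Literature.NumberTheory.Transcendental.Associators
import HarnessLib

/-!
# Associators: base change of the truncated Drinfeld–Kohno algebra; the pentagon descends

Companion of `Associators.lean` §3–§4 (`DrinfeldKohnoTrunc.map`, `NCSeries.DrinfeldPentagon.map`:
the pentagon is PRESERVED by every change of coefficients).  Here the converse direction for
injective maps of `ℚ`-algebras: **if `f : R → S` is an injective homomorphism of commutative
`ℚ`-algebras and `map f φ` satisfies Drinfeld's pentagon equation, then so does `φ`**
(`NCSeries.DrinfeldPentagon.of_map_injective`, `NCSeries.drinfeldPentagon_map_iff`).  In scheme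
language: the pentagon locus is a closed subscheme of the space of series defined over `ℚ`, so its
`R`-points are detected in any `ℚ`-algebra extension `S ⊇ R` [Drinfeld1991, §5 (the schemes
`M_μ`, defined over `ℚ`)]; [Furusho2011, §2] states the pentagon over an arbitrary field of
characteristic `0` by the same formula.

Used by the refuter of crux `PentagonInKZ` (route KontsevichZagierPeriods/FurushoPentagon, item
stmt-KontsevichZagierPeriods-11348) to show that the kernel form of the Kontsevich–Zagier conjecture
implies the pentagon for the rules associator: Drinfeld's pentagon over `ℝ`
(`drinfeldAssociator_pentagon_holds`) descends to the `ℚ`-subalgebra of `ℝ` generated by values of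
formal integral representations.

## Method

`DrinfeldKohnoTrunc R ι N` is a quotient of the free `R`-algebra by relations defined over `ℚ`
(indeed over `ℤ`), so it is the base change of `DrinfeldKohnoTrunc ℚ ι N`: the comparison map
`toModel : DrinfeldKohnoTrunc R ι N → R ⊗_ℚ DrinfeldKohnoTrunc ℚ ι N`, `t_ij ↦ 1 ⊗ t_ij`
(well defined: every defining relation holds after `includeRight`), is split by
`ofModel : r ⊗ x ↦ r · map(x)` (`ofModel_comp_toModel`, checked on generators), hence injective;
it is natural in `R` (`toModel_map`).  For `f : R → S` with a `ℚ`-linear retraction `ρ` (every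
injective `ℚ`-linear map of `ℚ`-vector spaces has one), `ρ ⊗ id` retracts `f ⊗ id` on the models, so
`map f` is injective (`map_injective`), and applying this to the two sides of the pentagon identity
in each weight truncation gives the descent.  Over a `ℚ`-algebra `R` the `ℚ`-algebra structure of
`DrinfeldKohnoTrunc R ι N` is the quotient one (`instAlgebraRat`, low priority).

## References

* V. G. Drinfel'd, *On quasitriangular quasi-Hopf algebras and on a group that is closely connected
  with Gal(Q̄/Q)*, Leningrad Math. J. 2 (1991), 829–860, §5. [Drinfeld1991]
* H. Furusho, *Double shuffle relation for associators*, Ann. of Math. 174 (2011), §2.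
  [Furusho2011]
-/

noncomputable section

open scoped TensorProduct

universe u v w

namespace Literature.NumberTheory.Transcendental

namespace DrinfeldKohnoTrunc

section RatStructure

variable {R : Type u} [CommRing R] [Algebra ℚ R] {ι : Type v} {N : ℕ}

/-- Over a `ℚ`-algebra `R`, the truncated Drinfeld–Kohno algebra is a `ℚ`-algebra (quotient
structure; low priority so that for `R = ℚ` the defining instance is used). [folklore] -/
instance (priority := 50) instAlgebraRat : Algebra ℚ (DrinfeldKohnoTrunc R ι N) :=
  inferInstanceAs (Algebra ℚ (RingQuot (DrinfeldKohno.Rel R ι N)))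

/-- The `ℚ`- and `R`-actions form a tower. [folklore] -/
instance (priority := 50) instIsScalarTowerRat : IsScalarTower ℚ R (DrinfeldKohnoTrunc R ι N) :=
  inferInstanceAs (IsScalarTower ℚ R (RingQuot (DrinfeldKohno.Rel R ι N)))

end RatStructure

section Model

variable (R : Type u) [CommRing R] [Algebra ℚ R] (ι : Type v) (N : ℕ)

/-- `t_ij ↦ 1 ⊗ t_ij`: comparison map to the base-change model `R ⊗_ℚ (U𝔞_ι ⊗ ℚ/(deg > N))`.
[folklore] -/
def toModel : DrinfeldKohnoTrunc R ι N →ₐ[R] R ⊗[ℚ] DrinfeldKohnoTrunc ℚ ι N :=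
  RingQuot.liftAlgHom R ⟨FreeAlgebra.lift R (fun p : ι × ι =>
      Algebra.TensorProduct.includeRight (R := ℚ) (A := R) (t ℚ N p.1 p.2)),
    fun a b (hab : DrinfeldKohno.Rel R ι N a b) => by
    cases hab with
    | diag i => simp
    | symm i j =>
      rw [FreeAlgebra.lift_ι_apply, FreeAlgebra.lift_ι_apply, t_symm]
    | fourTerm i j k hij hjk hik =>
      simp only [map_mul, map_add, FreeAlgebra.lift_ι_apply]
      rw [← map_add, ← map_mul, ← map_mul, t_mul_add i j k hij hjk hik]
    | locality i j k l hij hik hil hjk hjl hkl =>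
      simp only [map_mul, FreeAlgebra.lift_ι_apply]
      rw [← map_mul, ← map_mul, t_comm i j k l hij hik hil hjk hjl hkl]
    | trunc g =>
      rw [map_list_prod, map_zero, List.map_ofFn]
      have h2 := congrArg (Algebra.TensorProduct.includeRight (R := ℚ) (A := R)
        (B := DrinfeldKohnoTrunc ℚ ι N)) (prod_t_eq_zero (R := ℚ) (N := N) g)
      rw [map_list_prod, map_zero, List.map_ofFn] at h2
      simpa [Function.comp_def] using h2⟩

/-- `toModel (t i j) = 1 ⊗ t i j`. [folklore] -/
@[simp] theorem toModel_t (i j : ι) :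
    toModel R ι N (t R N i j) = (1 : R) ⊗ₜ[ℚ] t ℚ N i j :=
  (RingQuot.liftAlgHom_mkAlgHom_apply R _ _ _).trans (FreeAlgebra.lift_ι_apply _ _)

/-- `U𝔞 ⊗ ℚ → U𝔞 ⊗ R` as a map of `ℚ`-algebras. [folklore] -/
def ofRat : DrinfeldKohnoTrunc ℚ ι N →ₐ[ℚ] DrinfeldKohnoTrunc R ι N :=
  (map (algebraMap ℚ R)).toRatAlgHom

/-- `ofRat` is `map (algebraMap ℚ R)`. [folklore] -/
@[simp] theorem ofRat_apply (x : DrinfeldKohnoTrunc ℚ ι N) :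
    ofRat R ι N x = map (algebraMap ℚ R) x := rfl

/-- `r ⊗ x ↦ r · x`: the model maps back. [folklore] -/
def ofModel : R ⊗[ℚ] DrinfeldKohnoTrunc ℚ ι N →ₐ[R] DrinfeldKohnoTrunc R ι N :=
  Algebra.TensorProduct.lift (Algebra.ofId R _) (ofRat R ι N)
    (fun r _ => Algebra.commute_algebraMap_left r _)

/-- `ofModel (r ⊗ x) = r • map x`. [folklore] -/
@[simp] theorem ofModel_tmul (r : R) (x : DrinfeldKohnoTrunc ℚ ι N) :
    ofModel R ι N (r ⊗ₜ[ℚ] x) = r • map (algebraMap ℚ R) x := by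
  simp [ofModel, Algebra.TensorProduct.lift_tmul, Algebra.smul_def, Algebra.ofId_apply]

/-- `ofModel ∘ toModel = id`. [folklore] -/
theorem ofModel_comp_toModel : (ofModel R ι N).comp (toModel R ι N) = AlgHom.id R _ := by
  refine RingQuot.ringQuot_ext' (S := R) _ _ (FreeAlgebra.hom_ext (funext fun p => ?_))
  change ofModel R ι N (toModel R ι N (t R N p.1 p.2)) = t R N p.1 p.2
  rw [toModel_t, ofModel_tmul, map_t, one_smul]

/-- `ofModel (toModel x) = x`. [folklore] -/
theorem ofModel_toModel (x : DrinfeldKohnoTrunc R ι N) : ofModel R ι N (toModel R ι N x) = x :=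
  AlgHom.congr_fun (ofModel_comp_toModel R ι N) x

/-- **The comparison map to the base-change model is injective.** [folklore] -/
theorem toModel_injective : Function.Injective (toModel R ι N) :=
  Function.LeftInverse.injective (g := ofModel R ι N) (ofModel_toModel R ι N)

omit [Algebra ℚ R] in
/-- Induction principle: scalars, generators, sums, products. [folklore] -/
theorem induction_on' {P : DrinfeldKohnoTrunc R ι N → Prop} (x : DrinfeldKohnoTrunc R ι N)
    (halg : ∀ r : R, P (algebraMap R _ r)) (ht : ∀ i j, P (t R N i j))
    (hadd : ∀ x y, P x → P y → P (x + y)) (hmul : ∀ x y, P x → P y → P (x * y)) : P x := by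
  obtain ⟨a, rfl⟩ := RingQuot.mkAlgHom_surjective R (DrinfeldKohno.Rel R ι N) x
  induction a using FreeAlgebra.induction with
  | grade0 r => rw [AlgHom.commutes]; exact halg r
  | grade1 p => exact ht p.1 p.2
  | add a b ha hb => rw [map_add]; exact hadd _ _ ha hb
  | mul a b ha hb => rw [map_mul]; exact hmul _ _ ha hb

end Model

section Naturality

variable {R : Type u} [CommRing R] [Algebra ℚ R] {S : Type w} [CommRing S] [Algebra ℚ S]
  (ι : Type v) (N : ℕ)

/-- **Naturality of the comparison map**: `toModel ∘ map f = (f ⊗ id) ∘ toModel`. [folklore] -/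
theorem toModel_map (f : R →+* S) (x : DrinfeldKohnoTrunc R ι N) :
    toModel S ι N (map f x) =
      Algebra.TensorProduct.map f.toRatAlgHom (AlgHom.id ℚ (DrinfeldKohnoTrunc ℚ ι N))
        (toModel R ι N x) := by
  induction x using induction_on' R ι N with
  | halg r =>
    rw [map_algebraMap, AlgHom.commutes, AlgHom.commutes, Algebra.TensorProduct.algebraMap_apply,
      Algebra.TensorProduct.algebraMap_apply, Algebra.TensorProduct.map_tmul]
    simp
  | ht i j =>
    rw [map_t, toModel_t, toModel_t, Algebra.TensorProduct.map_tmul, map_one, AlgHom.id_apply]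
  | hadd x y hx hy => rw [map_add, map_add, hx, hy, map_add, map_add]
  | hmul x y hx hy => rw [map_mul, map_mul, hx, hy, map_mul, map_mul]

/-- **Base change along a split injection of `ℚ`-algebras is injective**: if `f : R → S` has a
`ℚ`-linear retraction `ρ` then `map f : U𝔞 ⊗ R/(deg>N) → U𝔞 ⊗ S/(deg>N)` is injective (compare
both sides with `R ⊗_ℚ U𝔞_ℚ`, `S ⊗_ℚ U𝔞_ℚ`, where `ρ ⊗ id` retracts `f ⊗ id`). [folklore] -/
theorem map_injective_of_leftInverse {f : R →+* S} (ρ : S →ₗ[ℚ] R) (hρ : ∀ r, ρ (f r) = r) :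
    Function.Injective (map (ι := ι) (N := N) f) := by
  intro x y hxy
  apply toModel_injective R ι N
  have key : ∀ w : R ⊗[ℚ] DrinfeldKohnoTrunc ℚ ι N,
      TensorProduct.map ρ LinearMap.id
        (Algebra.TensorProduct.map f.toRatAlgHom (AlgHom.id ℚ (DrinfeldKohnoTrunc ℚ ι N)) w) = w := by
    intro w
    induction w using TensorProduct.induction_on with
    | zero => simp
    | tmul r d => simp [hρ]
    | add a b ha hb => rw [map_add, map_add, ha, hb]
  rw [← key (toModel R ι N x), ← key (toModel R ι N y), ← toModel_map, ← toModel_map, hxy]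

/-- **Injective maps of `ℚ`-algebras induce injective base change.** [folklore] -/
theorem map_injective {f : R →+* S} (hf : Function.Injective f) :
    Function.Injective (map (ι := ι) (N := N) f) := by
  obtain ⟨g, hg⟩ := LinearMap.exists_leftInverse_of_injective f.toRatAlgHom.toLinearMap
    (LinearMap.ker_eq_bot.mpr hf)
  exact map_injective_of_leftInverse ι N g fun r => LinearMap.congr_fun hg r

end Naturality

end DrinfeldKohnoTrunc

namespace NCSeries

variable {R : Type u} [CommRing R] [Algebra ℚ R] {S : Type w} [CommRing S] [Algebra ℚ S]

/-- **Injective maps of `ℚ`-algebras reflect Drinfeld's pentagon**: if `f : R → S` is injective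
and `map f φ` satisfies the pentagon, so does `φ` (converse companion of `DrinfeldPentagon.map`;
e.g. the inclusion of a `ℚ`-subalgebra of `ℝ`). [folklore] -/
theorem DrinfeldPentagon.of_map_injective {φ : NCSeries Bool R} (f : R →+* S)
    (hf : Function.Injective f) (h : DrinfeldPentagon (NCSeries.map f φ)) :
    DrinfeldPentagon φ := by
  intro N
  apply DrinfeldKohnoTrunc.map_injective (Fin 4) N hf
  simpa only [map_mul, map_add, map_subst₂, t₄, DrinfeldKohnoTrunc.map_t] using h N

/-- Hence for injective `f` the pentagon for `φ` and for `map f φ` are equivalent. [folklore] -/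
theorem drinfeldPentagon_map_iff {φ : NCSeries Bool R} (f : R →+* S)
    (hf : Function.Injective f) : DrinfeldPentagon (NCSeries.map f φ) ↔ DrinfeldPentagon φ :=
  ⟨DrinfeldPentagon.of_map_injective f hf, fun h => h.map f⟩

end NCSeries

end Literature.NumberTheory.Transcendental
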